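import Summits.BirchSwinnertonDyer.BirchSwinnertonDyer.Theses.PrintCf2
import Summits.BirchSwinnertonDyer.BirchSwinnertonDyer.Theorems.CMKolyvaginAtInertTwoStarDoorOneBitBSDTwoOfPrintedInputs
import HarnessLib

/-!
# `PrintCf2.InertTwoStarDoorOneBitOfFactsPlus` holds (aside stmt-BirchSwinnertonDyer-29525, route PrintCf2 rev 58)

Cell `bsd-print-cf2`, planner g22 rev 58 (2026-08-30, HOME `bsd-print-cf2-plan/routeA58/AsidesCertStar.lean`): the
conductor-free Kriz–Li (★)-door on one-bit Heegner fields — the aside's text is the type of bsd-line-cmk2-p1 g22's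
`Summit.BirchSwinnertonDyer.BirchSwinnertonDyer.Theorems.KolyvaginLowerTwo.bsdp_two_of_exists_assumptionStar_oneBit_of_printedInputs`
(p763542) with the print binders in the order `(hnf, hGZ, hGZK, …)`. Pure plumbing: `intro`s + one `exact` (the planner's
kernel-checked closer, verbatim). No summit statement is proved here; the aside is conditional on its six printed inputs;
BSD is not proved by any of this.
-/

set_option autoImplicit false
set_option linter.dupNamespace false

namespace Summit.BirchSwinnertonDyer.BirchSwinnertonDyer.Theorems.PrintCf2

/-- The aside `InertTwoStarDoorOneBitOfFactsPlus` of route `PrintCf2` (item stmt-BirchSwinnertonDyer-29525) holds: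
cmk2-p1 g22's conductor-free (★)-door `bsdp_two_of_exists_assumptionStar_oneBit_of_printedInputs` (p763542), binders
reordered. -/
theorem inertTwoStarDoorOneBitOfFactsPlus_proof :
    Summit.BirchSwinnertonDyer.BirchSwinnertonDyer.Theses.PrintCf2.InertTwoStarDoorOneBitOfFactsPlus := by
  intro hmod hGZall hGZK hMilne hBF W _ _ _ hCM hin hsurj hr hT hc2 hpack
  exact Summit.BirchSwinnertonDyer.BirchSwinnertonDyer.Theorems.KolyvaginLowerTwo.bsdp_two_of_exists_assumptionStar_oneBit_of_printedInputs
    hGZall hGZK hmod hMilne hBF W hCM hin hsurj hr hT hc2 hpack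

end Summit.BirchSwinnertonDyer.BirchSwinnertonDyer.Theorems.PrintCf2
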